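import Summits.HodgeConjecture.CorCM.B01.HeckePair
import Literature.AlgebraicGeometry.ShimuraVarieties.UnitaryBallQuotientKaehlerDatum
import Literature.AlgebraicGeometry.ShimuraVarieties.UnitaryBallLevelFiniteCover
import Literature.AlgebraicGeometry.ShimuraVarieties.UnitaryBallClassLiftTranslate
import HarnessLib

/-!
# COR-CM: the Kähler–rational datum of a Picard modular surface is invariant under the Hecke legs

Cell pub-hodgecm2 (COR-CM, Hodge ladder stage 2), lane KAEHLER-HECKE-INV (b10): the CorCM junction of the Literature
chain `UnitaryBallPoincareSystem` → `UnitaryBallAutomorphicFubiniStudyForm` → `UnitaryBallAutomorphicFubiniStudyExact`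
→ `UnitaryBallQuotientKaehlerDatum`. For the realising surfaces `X_Γ = Var.scheme hU h₃ (.pms (pmsCode L ι₁ V Γ))` of the
model universe (anisotropic hermitian `3`-space `V` over the CM field `L`, levels `Γ`), it records:

* `BallDatum.frameIso_conj_mem_ballImage` — group bookkeeping: if `g ∈ U(H^{τ₁})` conjugates `Γ'^{τ₁}` into `Γ^{τ₁}` in
  `GL₃(ℂ)`, then the ball image `ĝ = T⁻¹ g T ∈ U(2,1)` conjugates `Δ' = ρ(Γ')` into `Δ = ρ(Γ)` (same Sylvester frame);
* `BallDatum.anMap_quotModel_mk` — a morphism `f : X₁ ⟶ X₂` with `f(ℂ) (unif₁ v) = unif₂ (g v)` on the cone lifts, in the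
  quotient Hodge models, to `Δ₁ z ↦ Δ₂ (ĝ z)` (the tree's `anMap_modelUnif_mulVec` with `ψ = mk`, `modelUnif_quotModel`);
* **`Model.exists_kaehlerRationalDatum_pull_eq`** — for every level `Γ` with `(pmsCode L ι₁ V Γ).IsAnisotropic` there is a
  Kähler–rational datum `D` of `X_Γ` whose class has EQUAL pull-backs `BettiUniverse.pull f 2 D.η = BettiUniverse.pull f' 2 D.η`
  along any two morphisms `f, f' : X_{Γ'} ⟶ X_Γ` lying over `v ↦ γ^{ι₁} v`, `v ↦ γ'^{ι₁} v` on the negative cone for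
  rational isometries `γ, γ' ∈ U(V₃,h)(L)` with `γ Γ' γ⁻¹ ≤ Γ`, `γ' Γ' γ'⁻¹ ≤ Γ`
  (`UnitaryBallUniformisationDatum.exists_kaehlerRationalDatum_map_eq`);
* `Model.exists_kaehlerRationalDatum_pull_levelCover_eq_pull_heckeTranslate` — the same for the two legs of a Hecke
  correspondence in the shape produced by `exists_levelCover` (`f₁` over `v ↦ v`, `Γ' ≤ Γ`) and `exists_heckeTranslate`
  (`g` over `v ↦ γ^{ι₁} v`, `γ Γ' γ⁻¹ ≤ Γ`): `pull f₁ 2 D.η = pull g 2 D.η` — the residual (ℓ) «`f₁^*η = g^*η` for one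
  Kähler–rational datum of `X_Γ`» of the Hecke–Hodge dictionary line (s2crux-idea-2, R-A) of the S2 crux, for ONE `D`
  per level, uniform in `Γ'`, `γ`, `f₁`, `g`.

The universe data `hU`, `h₃` are IMPLICIT (read off the schemes `Var.scheme hU h₃ _`); no further hypothesis binders; no definitions;
no named facts. HC_CM is NOT proved here or anywhere; this file discharges one displayed input of a hedge line.

References: G. Shimura, *Introduction to the Arithmetic Theory of Automorphic Functions* (1971), §3.1, §7.2–7.3;
N. Bergeron, J. Millson, C. Moeglin, Acta Math. 216 (2016), Part 2 §1.8; C. Voisin, *Hodge Theory and Complex Algebraic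
Geometry I* (2002), §7.1.2.
-/

noncomputable section

open scoped Matrix
open NumberField CategoryTheory MulAction
open Literature.AlgebraicGeometry.Motives
open Literature.AlgebraicGeometry.ShimuraVarieties
open Literature.AlgebraicGeometry.HodgeTheory
open Literature.NumberTheory.Automorphic
open Literature.Geometry.ComplexHyperbolic.BallModel (U21 Ball)
open Literature.AlgebraicTopology.SingularHomology (singularCohomology)

namespace Summit.HodgeConjecture.CorCM

/-! ### Ball-datum bookkeeping: conjugation of ball images, lifts in the quotient models -/

namespace BallDatum

open Literature.AlgebraicGeometry.ShimuraVarieties.UnitaryBallUniformisationDatum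

variable {X₁ X₂ : SchemeOver ℂ} (D₁ : UnitaryBallUniformisationDatum 2 X₁) (D₂ : UnitaryBallUniformisationDatum 2 X₂)

/-- **Conjugation of ball images.** If `g ∈ U(H^{τ₁})` conjugates `Γ₁^{τ₁}` into `Γ₂^{τ₁}` in `GL₃(ℂ)`, then
`ĝ = T⁻¹ g T ∈ U(2,1)` conjugates `Δ₁ = ρ_𝔣(Γ₁)` into `Δ₂ = ρ_𝔣(Γ₂)` (one Sylvester frame `T` for both data).
[cite: Shimura1971, §3.1 Prop. 3.1] -/
theorem frameIso_conj_mem_ballImage (hH : D₁.Hℂ = D₂.Hℂ) (𝔣 : D₂.SylvesterFrame) {g : GL (Fin 3) ℂ}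
    (hg : g ∈ D₂.realPoints)
    (hΓ : (D₁.Γ.map (Matrix.GeneralLinearGroup.map D₁.τ₁)).map (MulAut.conj g).toMonoidHom ≤
      D₂.Γ.map (Matrix.GeneralLinearGroup.map D₂.τ₁)) :
    ∀ δ ∈ D₁.ballImage (SylvesterFrame.transport hH 𝔣),
      D₂.frameIso 𝔣 ⟨g, hg⟩ * δ * (D₂.frameIso 𝔣 ⟨g, hg⟩)⁻¹ ∈ D₂.ballImage 𝔣 := by
  intro δ hδ
  obtain ⟨γ₁, rfl⟩ := (D₁.mem_ballImage_iff _).1 hδ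
  have hmem : (MulAut.conj g) (Matrix.GeneralLinearGroup.map D₁.τ₁ (γ₁ : GL (Fin 3) D₁.E)) ∈
      D₂.Γ.map (Matrix.GeneralLinearGroup.map D₂.τ₁) :=
    hΓ (Subgroup.mem_map_of_mem _ (Subgroup.mem_map_of_mem _ γ₁.2))
  obtain ⟨γ₂', hγ₂', hγ₂⟩ := Subgroup.mem_map.1 hmem
  refine (D₂.mem_ballImage_iff 𝔣).2 ⟨⟨γ₂', hγ₂'⟩, Subtype.ext ?_⟩
  have h2 : ((D₂.toRealPoints ⟨γ₂', hγ₂'⟩ : D₂.realPoints) : GL (Fin 3) ℂ) =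
      g * Matrix.GeneralLinearGroup.map D₁.τ₁ (γ₁ : GL (Fin 3) D₁.E) * g⁻¹ := by
    rw [show ((D₂.toRealPoints ⟨γ₂', hγ₂'⟩ : D₂.realPoints) : GL (Fin 3) ℂ) =
      Matrix.GeneralLinearGroup.map D₂.τ₁ γ₂' from rfl, hγ₂]
    rfl
  have h1 : ((D₁.toRealPoints γ₁ : D₁.realPoints) : GL (Fin 3) ℂ) =
      Matrix.GeneralLinearGroup.map D₁.τ₁ (γ₁ : GL (Fin 3) D₁.E) := rfl
  rw [ballRep_apply, ballRep_apply, Subgroup.coe_mul, Subgroup.coe_mul, Subgroup.coe_inv, coe_frameIso,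
    coe_frameIso, coe_frameIso, h2, h1, SylvesterFrame.transport_T]
  group

/-- **Lift of a morphism over a translation, in the quotient Hodge models.** If `f : X₁ ⟶ X₂` satisfies
`f(ℂ) (unif₁ v) = unif₂ (g v)` on the negative cone for `g ∈ U(H^{τ₁})` (data with the same Gram matrix, one frame),
then `f^an (Δ₁ z) = Δ₂ (ĝ z)` for `ĝ = T⁻¹ g T ∈ U(2,1)` (`anMap_modelUnif_mulVec` read with `ψ = mk`).
[cite: Shimura1971, §7.2–7.3] -/
theorem anMap_quotModel_mk (hH : D₁.Hℂ = D₂.Hℂ) (𝔣 : D₂.SylvesterFrame) {g : GL (Fin 3) ℂ} (hg : g ∈ D₂.realPoints)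
    (f : X₁ ⟶ X₂)
    (hf : ∀ v ∈ D₁.cone, AlgPoints.map f (D₁.unif v) = D₂.unif ((g : Matrix (Fin 3) (Fin 3) ℂ) *ᵥ v)) (z : Ball) :
    HodgeModel.anMap (D₂.quotModel 𝔣) (D₁.quotModel (SylvesterFrame.transport hH 𝔣)) f
        (D₁.quotientSurfaceMk (SylvesterFrame.transport hH 𝔣) z) =
      D₂.quotientSurfaceMk 𝔣 (D₂.frameIso 𝔣 ⟨g, hg⟩ • z) := by
  rw [← D₁.modelUnif_quotModel, ← D₂.modelUnif_quotModel]
  exact D₂.anMap_modelUnif_mulVec D₁ (D₂.quotModel 𝔣) (D₁.quotModel (SylvesterFrame.transport hH 𝔣)) f 𝔣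
    (SylvesterFrame.transport hH 𝔣) rfl hg hf z

end BallDatum

/-! ### The cover-stable Kähler–rational datum of the realising surfaces -/

namespace Model

open Literature.NumberTheory.Automorphic.PicardCM

section Data

variable {hU : BallQuotientUniformisedDatum} {h₃ : CMAbelianVarietyRealised}
variable {L : CMField} {ι₁ : L →+* ℂ} {V : HermSpace3 L ι₁}

/-- **A Kähler–rational datum of `X_Γ` invariant under all morphisms from other levels lifting to rational
translations of the ball.** For `Γ` with `(pmsCode L ι₁ V Γ).IsAnisotropic` there is `D : KaehlerRationalDatum 2 X_Γ` with
`BettiUniverse.pull f 2 D.η = BettiUniverse.pull f' 2 D.η` for all `f, f' : X_{Γ'} ⟶ X_Γ` over `v ↦ γ^{ι₁} v`,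
`v ↦ γ'^{ι₁} v` (`γ, γ' ∈ U(V₃,h)(L)`, `γ Γ' γ⁻¹ ≤ Γ`, `γ' Γ' γ'⁻¹ ≤ Γ`).
[cite: Shimura1971, §3.1 Prop. 3.1, §7.2–7.3] [cite: VoisinHodgeI2002, §7.1.2] -/
theorem exists_kaehlerRationalDatum_pull_eq (Γ : Level V) (h : (pmsCode L ι₁ V Γ).IsAnisotropic) :
    ∃ D : KaehlerRationalDatum 2 (Var.scheme hU h₃ (.pms (pmsCode L ι₁ V Γ))),
      ∀ (Γ' : Level V) (h' : (pmsCode L ι₁ V Γ').IsAnisotropic)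
        (f f' : Var.scheme hU h₃ (.pms (pmsCode L ι₁ V Γ')) ⟶ Var.scheme hU h₃ (.pms (pmsCode L ι₁ V Γ)))
        (γ γ' : GL (Fin 3) L) (hγ : γ ∈ unitaryGroup (cmConjRingHom L) V.Hm)
        (hγ' : γ' ∈ unitaryGroup (cmConjRingHom L) V.Hm)
        (_ : Γ'.Γ.map (MulAut.conj γ).toMonoidHom ≤ Γ.Γ) (_ : Γ'.Γ.map (MulAut.conj γ').toMonoidHom ≤ Γ.Γ)
        (_ : ∀ v ∈ (Var.ballDatum hU h₃ (pmsCode L ι₁ V Γ') h').cone,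
          AlgPoints.map f ((Var.ballDatum hU h₃ (pmsCode L ι₁ V Γ') h').unif v) =
            (Var.ballDatum hU h₃ (pmsCode L ι₁ V Γ) h).unif (((γ : Matrix (Fin 3) (Fin 3) L).map ι₁) *ᵥ v))
        (_ : ∀ v ∈ (Var.ballDatum hU h₃ (pmsCode L ι₁ V Γ') h').cone,
          AlgPoints.map f' ((Var.ballDatum hU h₃ (pmsCode L ι₁ V Γ') h').unif v) =
            (Var.ballDatum hU h₃ (pmsCode L ι₁ V Γ) h).unif (((γ' : Matrix (Fin 3) (Fin 3) L).map ι₁) *ᵥ v)),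
        BettiUniverse.pull f 2 D.η = BettiUniverse.pull f' 2 D.η := by
  set D₂ := Var.ballDatum hU h₃ (pmsCode L ι₁ V Γ) h with hD₂
  obtain ⟨𝔣⟩ := D₂.nonempty_sylvesterFrame
  obtain ⟨K, hK⟩ := D₂.exists_kaehlerRationalDatum_map_eq 𝔣
  refine ⟨K, fun Γ' h' f f' γ γ' hγ hγ' hconj hconj' hf hf' ↦ ?_⟩
  set D₁ := Var.ballDatum hU h₃ (pmsCode L ι₁ V Γ') h' with hD₁
  have hH : D₁.Hℂ = D₂.Hℂ := ballDatum_Hℂ_eq hU h₃ Γ Γ' h' h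
  have hg := map_ι₁_mem_realPoints_ballDatum hU h₃ Γ h hγ
  have hg' := map_ι₁_mem_realPoints_ballDatum hU h₃ Γ h hγ'
  exact hK D₁ (UnitaryBallUniformisationDatum.SylvesterFrame.transport hH 𝔣) f f' (D₂.frameIso 𝔣 ⟨_, hg⟩) (D₂.frameIso 𝔣 ⟨_, hg'⟩)
    (BallDatum.frameIso_conj_mem_ballImage D₁ D₂ hH 𝔣 hg (ballDatum_map_Γ_conj_le hU h₃ hconj h' h))
    (BallDatum.frameIso_conj_mem_ballImage D₁ D₂ hH 𝔣 hg' (ballDatum_map_Γ_conj_le hU h₃ hconj' h' h))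
    (BallDatum.anMap_quotModel_mk D₁ D₂ hH 𝔣 hg f hf) (BallDatum.anMap_quotModel_mk D₁ D₂ hH 𝔣 hg' f' hf')

/-- **The Kähler class is compatible with the two legs of a Hecke correspondence** — the shape of the legs of
`exists_levelCover` (`f₁` over `v ↦ v`, `Γ' ≤ Γ`) and `exists_heckeTranslate` (`g` over `v ↦ γ^{ι₁} v`, `γ Γ' γ⁻¹ ≤ Γ`):
ONE Kähler–rational datum `D` of `X_Γ` with `f₁^* D.η = g^* D.η` for all such pairs — the residual (ℓ) of the
Hecke–Hodge dictionary line (making `τ'_{f₁} ∘ g^*` adjoint to `τ'_g ∘ f₁^*` for the polarisation `Q_{D.η}` of `H¹`).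
[cite: Shimura1971, §7.2–7.3] [cite: BergeronMillsonMoeglin2016Balls, Part 2 §1.8] [cite: VoisinHodgeI2002, §7.1.2] -/
theorem exists_kaehlerRationalDatum_pull_levelCover_eq_pull_heckeTranslate (Γ : Level V)
    (h : (pmsCode L ι₁ V Γ).IsAnisotropic) :
    ∃ D : KaehlerRationalDatum 2 (Var.scheme hU h₃ (.pms (pmsCode L ι₁ V Γ))),
      ∀ (Γ' : Level V) (h' : (pmsCode L ι₁ V Γ').IsAnisotropic)
        (f₁ g : Var.scheme hU h₃ (.pms (pmsCode L ι₁ V Γ')) ⟶ Var.scheme hU h₃ (.pms (pmsCode L ι₁ V Γ)))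
        (γ : GL (Fin 3) L) (hγ : γ ∈ unitaryGroup (cmConjRingHom L) V.Hm)
        (_ : Γ'.Γ ≤ Γ.Γ) (_ : Γ'.Γ.map (MulAut.conj γ).toMonoidHom ≤ Γ.Γ)
        (_ : ∀ v ∈ (Var.ballDatum hU h₃ (pmsCode L ι₁ V Γ') h').cone,
          AlgPoints.map f₁ ((Var.ballDatum hU h₃ (pmsCode L ι₁ V Γ') h').unif v) =
            (Var.ballDatum hU h₃ (pmsCode L ι₁ V Γ) h).unif v)
        (_ : ∀ v ∈ (Var.ballDatum hU h₃ (pmsCode L ι₁ V Γ') h').cone,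
          AlgPoints.map g ((Var.ballDatum hU h₃ (pmsCode L ι₁ V Γ') h').unif v) =
            (Var.ballDatum hU h₃ (pmsCode L ι₁ V Γ) h).unif (((γ : Matrix (Fin 3) (Fin 3) L).map ι₁) *ᵥ v)),
        BettiUniverse.pull f₁ 2 D.η = BettiUniverse.pull g 2 D.η := by
  obtain ⟨D, hD⟩ := exists_kaehlerRationalDatum_pull_eq (hU := hU) (h₃ := h₃) Γ h
  refine ⟨D, fun Γ' h' f₁ g γ hγ hle hconj hf₁ hg ↦ hD Γ' h' f₁ g 1 γ (Subgroup.one_mem _) hγ ?_ hconj ?_ hg⟩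
  · intro δ hδ
    obtain ⟨δ', hδ', rfl⟩ := Subgroup.mem_map.1 hδ
    simpa using hle hδ'
  · intro v hv
    rw [hf₁ v hv]
    simp

end Data

end Model

end Summit.HodgeConjecture.CorCM

end
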